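import Literature.AlgebraicGeometry.ShimuraVarieties.RapoportSmithlingZhang2020.Sec3IntegralModels   -- ★ file 1: `Sec3Data`, `M0Obj`, `signatureFn`, `coarse`, carriers
import HarnessLib

/-!
# [RapoportSmithlingZhang2020Diagonal] §4 «Semi-global integral models» — the rows cited by the HC_CM lines (§4.1 incl. (4.6) and Thm. 4.1,
# (4.15)–(4.16); §4.3 (4.19), Lemma 4.3, Thm. 4.5, (4.23)), STATED AS PRINTED (named-fact carpet; NO proofs, NO `sorry`, NO instance, NO notation)

M. Rapoport, B. Smithling, W. Zhang, *Arithmetic diagonal cycles on unitary Shimura varieties*, Compos. Math. **156** (2020) = arXiv:1710.06962 **v6**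
(bib key `RapoportSmithlingZhang2020Diagonal`).  PAGE PINS «p. N» = arXiv v6 page (cell text of record `F0/P6/lit1/RSZ2020-v6-pages.txt`; house form of the
existing tree tags); numbering per section: §4 opens p. 15; §4.1 «Hyperspecial level at `v₀`» pp. 15–18 ((4.1)–(4.2) p. 15, (4.3)–(4.8) p. 16, (4.9)–(4.12) +
**Theorem 4.1** p. 17, (4.13)–(4.17) p. 18); §4.2 «Split level at `v₀`» pp. 18–19 (Theorem 4.2, (4.18) p. 19); §4.3 «Drinfeld level at `v₀`» pp. 19–22
(**(4.19)**, Lemma 4.3, Remark 4.4 p. 19, (4.20)–(4.22) + **Theorem 4.5** p. 20, **(4.23)** p. 21, (4.24) p. 22); §4.4 «AT parahoric level at `v₀`» pp. 22–27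
(Remark 4.6 p. 23, Theorem 4.7 + Remarks 4.8–4.9 p. 24, Remark 4.10 + Lemma 4.11 p. 25, Lemmas 4.12–4.13 p. 26, Lemma 4.14 + Remark 4.15 p. 27).

Cell `hodgecm-mathlib`, GO-500 carpet squad TL (seat TL-t10), file 2 of the t10 deal (TL-plan 2026-09-02 02:02:40Z: «file 2 `Sec4CitedRows.lean` = §4.1 incl.
(4.6), Thm 4.1, (4.19), §4.3 (4.23), §4.4»; tree census of the rows actually cited by the HLiu418∕H413 lines: «§4.1 p. 17» ×13, «§4.1 Thm. 4.1 p. 17» ×11,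
«§4.3 (4.23) p. 21» ×7, «§4.1 (4.6) p. 16» ×5, «(4.19) p. 19» ×1).  It EXTENDS file 1 (★ `Sec3IntegralModels`: the REAL `ShimuraDatum`, the ⟨CARRIER⟩
discipline, `M0Obj`, `signatureFn`, `coarse`) — same READINGS R1–R8; new READINGS R9–R13 below.  HONEST LABEL: HC_CM is proved only modulo the 7 printed
citations (2 remaining: hLiu418 = stmt-HodgeConjecture-24832, h413 = stmt-HodgeConjecture-24833) until rung 0 closes; this file asserts NOTHING — every item
is a `def … : Prop` taken by a consumer as a hypothesis `(h : Item D)` for ITS OWN datum `D`.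

## How the printed objects are typed (paper order)

* §4 setting (p. 15): «Fix a prime number `p` and an embedding `ν̃ : ℚ̄ → ℚ̄_p`. This determines a `p`-adic place `ν` of `E` and, via `φ₀`, places `v₀` of `F₀`
  and `w₀` of `F`.» = parameters `(p : ℕ) [Fact p.Prime]` and REAL fields `ν` (a non-zero prime of `O_E` above `p`), `w₀`, `v₀` with the printed compatibilities
  (`w₀ = φ₀^{-1}(ν)` through Mathlib `RingOfIntegers.mapRingHom` of the REAL `phi0ToReflexFieldOf`, `v₀ = w₀ ∩ O_{F₀}`).  The embedding `ν̃` itself enters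
  §4 only through **(4.7)–(4.8)** (p. 16: «we have used the embedding `ν̃` to identify `Hom_ℚ(F, ℚ̄) ≃ Hom_ℚ(F, ℚ̄_p)` (4.7), which in turn identifies
  `{φ ∈ Hom_ℚ(F, ℚ̄) ∣ w_φ = w} ≃ Hom_{ℚ_p}(F_w, ℚ̄_p)` (4.8), where `w_φ` denotes the `p`-adic place in `F` induced by `ν̃ ∘ φ`») = READING R9: the ⟨CARRIER⟩
  map `placeOf : Hom(F, ℂ) → {places of F}` («`φ ↦ w_φ`») with its three REAL constraints (`w_φ ∣ p`, `w_{φ₀} = w₀`, and (4.8): `#{φ ∣ w_φ = w} = [F_w : ℚ_p]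
  = e(w∣p) f(w∣p)`, Mathlib `Ideal.ramificationIdx` ∕ `Ideal.inertiaDeg` over `ℤ`).  «the ideal `𝔞` … is prime to `p`» (p. 15) = `𝔞_coprime`.
  `O_{E,(ν)}` = Mathlib `IsDedekindDomain.HeightOneSpectrum.valuationSubringAtPrime E ν` («the localization of `O_E` at `ν`», REAL, READING R10), with its
  algebra maps `O_E → O_{E,(ν)} → E`.  `O_F ⊗ ℤ_{(p)}` = the REAL localisation `OFp F p` of `O_F` at the image of `ℤ ∖ pℤ` (READING R11).
* §4.1 hypotheses (p. 15) «the place `v₀` is unramified over `p`, and … `v₀` either splits in `F` or is inert in `F` and the hermitian space `W_{v₀}` is split.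
  We also assume `p ≠ 2` if there is any `v ∈ 𝒱_p` which is non-split in `F`» = `HyperspecialHypotheses` (REAL: `e(v₀∣p) = 1`; two primes of `O_F` over `v₀`, or
  one with `e = 1`, `f = 2`; «`W_{v₀}` split» = `inv_{v₀}(W_{v₀}) = 1` (1.4) p. 6, i.e. `(−1)^{n(n−1)/2} det W` is a local norm at `v₀` — for `v₀` INERT and
  unramified in `F` this is «`ord_{v₀}((−1)^{n(n−1)/2} det W)` is even» (READING R12, the norm group of an unramified quadratic extension), stated with the REAL
  `v₀`-adic valuation of the REAL Gram determinant `detW₀ ∈ F₀` of ★ `HermSpace.gram`).  «For each `v ∈ 𝒱_p`, choose a vertex lattice `Λ_v` in the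
  `F_v/F_{0,v}`-hermitian space `W_v` … we may and do take `Λ_{v₀}` to be self-dual» (p. 15; vertex lattice of type `t`: `Λ ⊂^t Λ^∨ ⊂ π_v^{-1}Λ`, p. 7) =
  ⟨CARRIER⟩ `vertexType : 𝒱_p → ℕ` (the type `t = #`-length of `Λ_v^∨/Λ_v`, the only datum of `Λ_v` the rows below use) with `vertexType v₀ = 0` in the
  hypotheses; the lattices themselves (in completions `W ⊗ F_{0,v}`) are not constructed.  **(4.1)** «`K_G = K_G^p × K_{G,p}`, where `K_G^p ⊂ G(𝔸^p_{F₀,f})` is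
  arbitrary, and … `K_{G,p} := ∏_{v ∈ 𝒱_p} K_{G,v}` with `K_{G,v}` the stabilizer of `Λ_v` in `G(F_{0,v})`» = ⟨CARRIER⟩ subgroups `Kp` («`K_G^p`», read inside
  `G(𝔸_{F₀,f})` = ★ `HermSpace.Gfin` as `K_G^p × G(F₀ ⊗ ℚ_p)`) and `KGp` (read as `G(𝔸^p_{F₀,f}) × K_{G,p}`), so that `K_G = Kp ⊓ KGp` (REAL `def KG`; READING R13:
  the factorisation `G(𝔸_{F₀,f}) = G(𝔸^p_{F₀,f}) × G(F₀ ⊗ ℚ_p)` is not exposed by the tree's carrier).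
* §4.1 objects (pp. 15–17), over «each locally noetherian `O_{E,(ν)}`-scheme `S`»: «tuples `(A₀, ι₀, λ₀, A, ι, λ, η̄^p)`, where `(A₀, ι₀, λ₀)` is an object of
  `M₀^{𝔞,ξ}(S)`» (REAL ★ `M0Obj` over `S → Spec O_{E,(ν)} → Spec O_E`, label `ξ`); «`(A, ι)` is an abelian scheme over `S` with an `O_F ⊗ ℤ_{(p)}`-action `ι`
  satisfying the Kottwitz condition (3.11) of signature `((1, n−1)_{φ₀}, (0, n)_{φ ∈ Φ∖{φ₀}})`» (REAL ★ `AbelianSchemeOver` + ★ `RingAction (OFp F p)`; the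
  condition = ⟨CARRIER⟩ `IsKottwitzP` at the REAL ★ `signatureFn`, as READING R5 of file 1); «`λ` is a polarization on `A` whose Rosati involution induces on
  `O_F ⊗ ℤ_{(p)}` the non-trivial Galois automorphism of `F/F₀`» (REAL ★ `Polarization` + ⟨CARRIER⟩ `RosatiIsConjP`), «subject to the following condition …
  (4.2) `A[p^∞] = ∏_{v ∈ 𝒱_p} A[v^∞]` … `λ` induces a polarization `λ_v : A[v^∞] → A^∨[v^∞]` … The condition we impose is that `ker λ_v` is contained in
  `A[ι(π_v)]` of rank `#(Λ_v^∨/Λ_v)` for each `v ∈ 𝒱_p`» (⟨CARRIER⟩ `KerCondP` at the REAL `vertexType v`); **(4.3)** «`η̄^p` is a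
  `K_G^p`-orbit of `𝔸^p_{F,f}`-linear isometries `η^p : V̂^p(A₀, A) ≃ −W ⊗_F 𝔸^p_{F,f}`, where `V̂^p(A₀, A) := Hom_F(V̂^p(A₀), V̂^p(A))`, and the hermitian form on
  `V̂^p(A₀, A)` is the evident prime-to-`p` analog of (3.13)» (inside the ⟨CARRIER⟩ `Obj4`); «We also impose for each `v ≠ v₀` over `p` the sign condition and
  the Eisenstein condition»: **(4.4)** «`inv^r_v(A₀,s, ι₀,s, λ₀,s, A_s, ι_s, λ_s) = inv_v(−W_v)` at every point `s` of `S`» (only for `v` non-split; left side =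
  (A.5)∕(A.8) of App. A, locally constant by Prop. A.1) = ⟨CARRIER⟩ `SignCond`; **(4.10)** «`Q_{A_ψ}(ι(π)) ∣ Lie_ψ A[w^∞] = 0` for each `w ∣ v` and each
  `ψ ∈ Hom_{ℚ_p}(F_w^t, ℚ̄_p)`» (only when `S` has non-empty special fibre; (4.9) the decomposition `Lie A[w^∞] = ⊕_ψ Lie_ψ A[w^∞]`) = ⟨CARRIER⟩ `EisensteinCond`
  («The Kottwitz condition implies that the Eisenstein condition at `v` is automatically satisfied when the one or two places `w` over `v` are unramified over
  `p`, cf. Lemma B.3», p. 17 — recorded).  Morphisms (p. 17) «an isomorphism `(A₀, ι₀, λ₀) ≅ (A₀', ι₀', λ₀')` in `M₀^{𝔞,ξ}(S)` and a quasi-isogeny `A → A'` which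
  induces an isomorphism `A[p^∞] ≅ A'[p^∞]`, compatible with `ι` and `ι'`, with `λ` and `λ'`, and with `η̄^p` and `η̄^{p'}`» = ⟨CARRIER⟩ `Obj4Iso`.  The objects
  are the ⟨CARRIER⟩ type `Obj4 Kp f` (level structures on rational Tate modules and quasi-isogenies have no tree vocabulary) with REAL projections `intObjM0`
  (a ★ `M0Obj` of file 1, carrying (3.8)∕Rosati∕`ker λ₀ = A₀[𝔞]`), `intObjA`, `intObjι`, `intObjD`, `intObjPol`; that the projections satisfy the other printed
  clauses and that the `M₀`-component has label `ξ` are the AXIOMS `intObj_clauses`, `intObjM0_label` (`Prop` fields of the datum, not printed results —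
  no D-0026 debt; same discipline as file 1's `objM0_label`).
* **(4.5)–(4.6)** (p. 16) «there is a decomposition of the `p`-divisible group `A[p^∞]`, `A[p^∞] = ∏_{w ∣ p} A[w^∞]` (4.5) … Since we assume that `p` is locally
  nilpotent on `S`, … `Lie A = Lie A[p^∞] = ⊕_{w ∣ p} Lie A[w^∞]`.  For each place `w`, by the Kottwitz condition (3.11), the `p`-divisible group `A[w^∞]` is of
  height `n · [F_w : ℚ_p]` and dimension `dim A[w^∞] = Σ_{φ ∈ Hom(F_w, ℚ̄_p)} r_φ` (4.6).  Here `r_φ` is as in (3.14)» = `eq46_heightDim` over the ⟨CARRIER⟩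
  invariants `pdivHeight`, `pdivDim` of the `w`-block of `A[p^∞]` (the tree's `p`-divisible-group blocks ★ `PDivisibleGroupBlock*` are fibre-level and `n = 2`;
  READING R9 turns `Hom(F_w, ℚ̄_p)` into `{φ ∣ w_φ = w}` by (4.8)), with `p` locally nilpotent on `S` as printed.
* **Theorem 4.1** (p. 17) «The moduli problem just formulated is representable by a Deligne–Mumford stack `M_{K_G̃}(G̃)` smooth over `Spec O_{E,(ν)}`. For `K_G^p`
  small enough, `M_{K_G̃}(G̃)` is relatively representable over `M₀^{𝔞,ξ}`. Furthermore, the generic fiber `M_{K_G̃}(G̃) ×_{Spec O_{E,(ν)}} Spec E` is canonically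
  isomorphic to `M_{K_G̃}(G̃)` [of §3.2].» = `Thm41` over the ⟨CARRIER⟩ integral model `intModel Kp : SchemeOver O_{E,(ν)}` tied to `Obj4` by the ⟨CARRIER⟩
  classifying map `intPt` on geometric points — READ, as the HC_CM lines read it (n = 2, neat level), THROUGH A SCHEME: TYPED = for `K_G^p` small enough
  (`∃ K₀, ∀ Kp ≤ K₀`): `intPt` is a bijection `Obj4(Spec Ω)/≅ → (intModel Kp)(Ω)` for algebraically closed `Ω` over `O_{E,(ν)}` (representability ON GEOMETRIC
  POINTS), `intModel Kp → Spec O_{E,(ν)}` is smooth (Mathlib `Smooth`), and its generic fibre (★ `Motives.baseChange O_{E,(ν)} E`) is `E`-isomorphic to the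
  coarse space `coarse (K_G)` of Proposition 3.7 (file 1); the DM-stack wording and «relatively representable over `M₀^{𝔞,ξ}`» are RECORDED (no stacks in
  Mathlib ∕ tree).  -- TODO(general form): DM stacks (for general `𝔞`, `K` the moduli problem is not a scheme).
  Proof inputs recorded: [Kottwitz1992, p. 391] representability; local models [PappasRapoportSmithling2013] + App. B Lemmas B.1∕B.4, (4.11)–(4.12); [Gortz2001].
* (4.13)–(4.14) (the `H̃`-embeddings, `(u,u) ∈ O^×_{F₀,(p)}`, `Λ_v = Λ_v^♭ ⊕ O_{F,v}u`) and (4.17)–(4.18): RECORDED, not typed (no HC_CM citation).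
* **(4.15)–(4.16)** (p. 18) «Fix `g ∈ G̃(𝔸^p_f)` … `K'^p_G̃ := K^p_G̃ ∩ gK^p_G̃g^{-1}` and `K'_G̃ := K'^p_G̃ × K_{G̃,p}`. Then we obtain in the standard way a diagram of
  finite étale morphisms `M_{K'_G̃}(G̃) ⇉ M_{K_G̃}(G̃)` (`nat₁`, `nat_g`) (4.15) … for a central element `g = z ∈ Z(G)(𝔸^p_{F₀,f}) = {z ∈ (𝔸^p_{F,f})^× ∣
  Nm_{F/F₀}(z) = 1}`, the diagram (4.15) collapses to a map `M_{K_G̃}(G̃) →z M_{K_G̃}(G̃)` (4.16) and this induces an action of `Z(G)(𝔸^p_{F₀,f})` on `M_{K_G̃}(G̃)`»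
  = `hecke415` over the ⟨CARRIER⟩ maps `natOne`, `natG` between the integral models (REAL `K'^p = K^p ⊓ gK^pg^{-1}` by Mathlib's pointwise conjugation of
  subgroups; «prime to `p`» = `g ∈ GAwayP`, the ⟨CARRIER⟩ subgroup `G(𝔸^p_{F₀,f})` of READING R13): both maps finite (Mathlib `IsFinite`) and étale (Mathlib
  `Etale`); (4.16) is recorded in the docstring (central elements: `natOne` an isomorphism) — typed as `hecke416`.
* §4.2 (pp. 18–19) «We continue with the setup and assumptions of the previous subsection, except we now allow `v₀` to be ramified over `p`. In addition,
  we assume that `v₀` splits in `F`, say into `w₀` and another place `w̄₀` … tuples `(A₀, ι₀, λ₀, A, ι, λ, η̄^p)` as in the previous subsection, except that we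
  impose the further condition corresponding to `w̄₀` that when `p` is locally nilpotent on `S`, the `p`-divisible group `A[w̄₀^∞]` is a Lubin–Tate group of
  type `r|_{w̄₀}`, in the sense of [RapoportZink2017, §8] … if `v₀` is unramified over `p`, then this further Eisenstein condition is redundant, and the moduli
  functor `M_{K_G̃}(G̃)` is the same as the one defined in the previous subsection» = the REAL standing hypotheses `SplitDrinfeldHypotheses` of §§4.2–4.3 (two
  places of `F` over `v₀`; the `p ≠ 2` clause and `Λ_{v₀}` self-dual as in §4.1) and the ⟨CARRIER⟩ clause `LubinTateCond`, imposed on the objects (AXIOM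
  `intObj_clauses`) when `v₀` is ramified over `p` — so that the one ⟨CARRIER⟩ `intModel` is the integral model `M_{K_G̃}(G̃)` of §4.1 (Theorem 4.1) and of §4.2
  (**Theorem 4.2** p. 19, same three assertions as Theorem 4.1: INDEX only — not cited by the HC_CM lines), over which the §4.3 rows below are stated.
* §4.3 (p. 19): **(4.19)** «the matching condition between the CM type `Φ` and the chosen place `ν` of `E` …: `{φ ∈ Hom(F, ℚ̄) ∣ w_φ = w₀} ⊂ Φ`» = REAL
  predicate `MatchingCondition` (over `placeOf`; in case (ii) of Lemma 4.3 «the left-hand side of (4.19) is the singleton set `{φ₀}`»); **Lemma 4.3** «The matching condition for `Φ` and `ν` is satisfied in each of the following two situations. (i) `F` is of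
  the form `K F₀` for an imaginary quadratic field `K/ℚ`, `Φ` is the unique CM type induced from `K` containing `φ₀`, and `p` splits in `K`. (ii) The place `v₀`
  is of degree `1` over `ℚ`.» = `Lemma43` (REAL hypotheses: (i) as in file 1's `Rem31_harrisTaylor` + «`p` splits in `K`» = two primes of `O_K` above `p`; (ii)
  `e(v₀∣p) f(v₀∣p) = 1`); **Remark 4.4** «We call the case (i) the Harris–Taylor case» (INDEX).  «`K^m_G` … in the `v₀`-factor where `G(F_{0,v₀}) ≅ GL_n(F_{0,v₀})`,
  we take `K^m_{G,v₀}` to be the principal congruence subgroup modulo `p^m_{v₀}` inside `K_{G,v₀}`. In particular, `K_G` coincides with `K^m_G` for `m = 0`» =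
  ⟨CARRIER⟩ `Km : ℕ → Subgroup G(𝔸_{F₀,f})` with the REAL relation `Km 0 = KGp`; (4.20)–(4.22), `T_{w₀}(A₀, A)[w₀^m] := Hom_{O_{F,w₀}}(A₀[w₀^m], A[w₀^m])` and the
  Drinfeld `w₀^m`-structure **(4.21)** «`φ : π_{w₀}^{-m} Λ_{w₀}/Λ_{w₀} → Hom_{O_{F,w₀}}(A₀[w₀^m], A[w₀^m])`, which is a Drinfeld `w₀^m`-structure on the target, cf.
  [HarrisTaylorAMS2001, §II.2]» = inside the ⟨CARRIER⟩ objects `ObjDr m Kp f` (REAL projection `drObj` to `Obj4`).  **Theorem 4.5** (p. 20) «The moduli problem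
  `M_{K^m_G̃}(G̃)` is relatively representable by a finite flat morphism to `M_{K_G̃}(G̃)`. It is regular and flat over `Spec O_{E,(ν)}`. Furthermore, the generic fiber
  `M_{K^m_G̃}(G̃) ×_{Spec O_{E,(ν)}} Spec E` is canonically isomorphic to `M_{K^m_G̃}(G̃)`» = `Thm45` over ⟨CARRIER⟩ `drModel m Kp` and `drToInt m Kp : drModel → intModel`
  (over `O_{E,(ν)}`): TYPED = `drToInt` finite and flat (Mathlib `IsFinite`, `Flat`), `drModel → Spec O_{E,(ν)}` flat, generic fibre `E`-isomorphic to
  `coarse (Km m ⊓ Kp)`, `drModel` classifies `ObjDr` on geometric points compatibly with `intPt`, and «regular» = every local ring `O_{drModel, x}` is a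
  regular local ring (Mathlib `IsRegularLocalRing`).  **(4.23)** (p. 21) «For general `g ∈ G(F_{0,v₀})`, choose `μ` large enough that `p^μ_{v₀} Λ_{v₀} ⊂ g Λ_{v₀} ⊂ ϖ^{−m}_{v₀} g Λ_{v₀} ⊂ p^{−μ}_{v₀} Λ_{v₀}`.
  Then `K^{2eμ}_{G̃,v₀} ⊂ K^m_{G,v₀} ∩ gK^m_{G,v₀}g^{-1}`, where `e = e_{v₀}` is the ramification index of `v₀` over `p`. Hence we obtain a diagram of finite flat
  morphisms `M_{K^{2eμ}_G̃}(G̃) ⇉ M_{K^m_G̃}(G̃)` (`nat₁`, `nat_g`) (4.23)» = `hecke423` over the ⟨CARRIER⟩ maps `drNatOne`, `drNatG` (typed: finite and flat, for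
  `g ∈ GAtV₀` = the ⟨CARRIER⟩ factor `G(F_{0,v₀})`, `μ` large, `e = e(v₀∣p)` REAL); the moduli description of `nat_g` (pp. 21–22: `A' = A/C`,
  `C = C_{w₀} ⊕ C_{w₀}^⊥ ⊕ ∏_{v ≠ v₀} A[v^{e_v μ}]`, `p^{2μ}λ = ξ^∨ λ' ξ`, `φ'` from `φ`) is RECORDED — the tree's ★ `SerreTensorIntegralIdeal*`, ★
  `FrobeniusVersusHeckeSerreTensor*` type its `n = 2` instance; (4.24) and the `H̃`∕`H̃G` analogues recorded.
* §4.4 (pp. 22–27): AT types (1)–(4) p. 22, (4.25)–(4.29), Remark 4.6 p. 23, **Theorem 4.7** p. 24 («representable by a DM stack flat over `Spec O_{E,(ν)}` …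
  smooth in types (2)–(4), regular with semi-stable reduction in type (1)» — paraphrase of the INDEX only), Remarks 4.8–4.10, Lemmas 4.11–4.14 (finiteness ∕
  étaleness degrees of `π₁`, `M_{K'_H̃}(H̃) → M_{K_{H̃G}}(H̃G)`), Remark 4.15: RECORDED AS AN INDEX ONLY — no HC_CM line cites a §4.4 item (census: «§4.3–4.4
  pp. 20–21» ×1 is the Drinfeld-level material above).

## References
* [RapoportSmithlingZhang2020Diagonal] M. Rapoport, B. Smithling, W. Zhang, *Arithmetic diagonal cycles on unitary Shimura varieties*, Compos. Math. 156
  (2020) 1745–1824, arXiv:1710.06962v6 — §4 pp. 15–27 as itemised above; Notation (1.4) p. 6, p. 7 (vertex lattices).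
* [Kottwitz1992] R. E. Kottwitz, *Points on some Shimura varieties over finite fields*, JAMS 5 (1992) — p. 391 (representability; RSZ's [29]).
* [PappasRapoportSmithling2013] G. Pappas, M. Rapoport, B. Smithling, *Local models of Shimura varieties, I* (RSZ's [41]); [Gortz2001] (RSZ's [17]).
* [HarrisTaylorAMS2001] M. Harris, R. Taylor, *The geometry and cohomology of some simple Shimura varieties* (RSZ's [19]) — §II.2, Lemma III.4.1, §III.4.
* [KatzMazur1985] N. Katz, B. Mazur, *Arithmetic moduli of elliptic curves* (RSZ's [26]) — Cor. 1.10.3.  [RapoportZink2017] (RSZ's [48]) — §8, (8.2), (8.4).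
-/

noncomputable section

open NumberField CategoryTheory AlgebraicGeometry IsDedekindDomain
open scoped Matrix Classical Pointwise
open Literature.AlgebraicGeometry.Motives (CMType SchemeOver AlgPoints)
open Literature.AlgebraicGeometry.AbelianSchemes (AbelianSchemeOver)
open Literature.NumberTheory.Automorphic.Liu2021.AppendixC (HermSpace conj restr IsQuasiProjectiveOver)
open Literature.AlgebraicGeometry.ShimuraVarieties.RapoportSmithlingZhang2020.Sec3IntegralModels

namespace Literature.AlgebraicGeometry.ShimuraVarieties.RapoportSmithlingZhang2020.Sec4CitedRows

variable (F₀ F : Type) [Field F₀] [NumberField F₀] [IsTotallyReal F₀] [Field F] [NumberField F] [Algebra F₀ F]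
  [IsTotallyComplex F] [Algebra.IsQuadraticExtension F₀ F]

/-! ## §4 setting (p. 15): `p`, `O_F ⊗ ℤ_{(p)}`, `ν`, `v₀`, `w₀`, `O_{E,(ν)}` -/

/-- **`O_F ⊗ ℤ_{(p)}`** (p. 15: «an `O_F ⊗ ℤ_{(p)}`-action `ι`»), REAL as the localisation of `O_F` at the image of the multiplicative set `ℤ ∖ pℤ`
(READING R11: `O_F ⊗_ℤ ℤ_{(p)} = O_F[(ℤ ∖ pℤ)^{-1}]`). [cite: RapoportSmithlingZhang2020Diagonal, §4.1 p. 15] -/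
abbrev OFp (p : ℕ) [Fact p.Prime] : Type :=
  Localization (Algebra.algebraMapSubmonoid (𝓞 F) (Ideal.span {(p : ℤ)}).primeCompl)

section Helpers

variable {F₀ F}

/-- **`O_{E,(ν)}`** (p. 15: «integral models over `O_{E,(ν)}`»), the localisation of `O_E` at the prime `ν`, as Mathlib's valuation subring
`IsDedekindDomain.HeightOneSpectrum.valuationSubringAtPrime` of `E` (READING R10); `hE` = «`E` is a number field» (so that `O_E` is a Dedekind domain; the
tree's ★ `ComplexMultiplication.finiteDimensional_traceField_sup_fieldRange`, supplied by the datum — no instance is declared here).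
[cite: RapoportSmithlingZhang2020Diagonal, §4 p. 15] -/
abbrev OEνOf (Φ : CMType F) (φ₀ : F →+* ℂ) (hE : NumberField (reflexFieldOf Φ φ₀)) (ν : HeightOneSpectrum (𝓞 (reflexFieldOf Φ φ₀))) :
    ValuationSubring (reflexFieldOf Φ φ₀) :=
  letI := hE
  HeightOneSpectrum.valuationSubringAtPrime (reflexFieldOf Φ φ₀) ν

/-- The structure map `Spec O_{E,(ν)} → Spec O_E` (REAL), through which an `O_{E,(ν)}`-scheme is an `O_E`-scheme (the `M₀`-component of the §4.1 objects
lives over `O_E`, pp. 11, 15). [cite: RapoportSmithlingZhang2020Diagonal, §4.1 p. 15] -/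
def specOEνToSpecOEOf (Φ : CMType F) (φ₀ : F →+* ℂ) (hE : NumberField (reflexFieldOf Φ φ₀)) (ν : HeightOneSpectrum (𝓞 (reflexFieldOf Φ φ₀))) :
    Spec (.of (OEνOf Φ φ₀ hE ν)) ⟶ Spec (.of (𝓞 (reflexFieldOf Φ φ₀))) :=
  Spec.map (CommRingCat.ofHom (algebraMap (𝓞 (reflexFieldOf Φ φ₀)) (OEνOf Φ φ₀ hE ν)))

/-- `𝒱_p`, «the set of places `v` of `F₀` over `p`» (p. 15): the non-zero primes of `O_{F₀}` containing `p`. [cite: RapoportSmithlingZhang2020Diagonal, §4 p. 15] -/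
abbrev PlacesOverP (F₀ : Type) [Field F₀] [NumberField F₀] (p : ℕ) : Type :=
  {v : HeightOneSpectrum (𝓞 F₀) // (p : 𝓞 F₀) ∈ v.asIdeal}

/-- The `Ω`-valued points of a scheme `X` over a ring `R`, for an `R`-algebra `Ω`: `R`-morphisms `Spec Ω → X` (the ring-base analogue of the tree's ★
`Motives.AlgPoints`; non-Prop plumbing). [folklore] -/
abbrev PointsOver {R : Type} [CommRing R] (X : SchemeOver R) (Ω : Type) [CommRing Ω] [Algebra R Ω] : Type :=
  Over.mk (Spec.map (CommRingCat.ofHom (algebraMap R Ω))) ⟶ X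

end Helpers

/-- **The datum of [RSZ2020] §4 (setting p. 15, §4.1 pp. 15–17, §4.3 pp. 19–21)**, extending file 1's `Sec3Data` by the prime `p`, the places `ν ∣ p` of `E`,
`w₀` of `F`, `v₀` of `F₀` (REAL), the ⟨CARRIER⟩ place map `φ ↦ w_φ` of (4.7)–(4.8) with its REAL constraints, the vertex-lattice types and level subgroups
(4.1), the ⟨CARRIER⟩ clause predicates of the §4.1 moduli problem, its ⟨CARRIER⟩ objects with REAL projections, the ⟨CARRIER⟩ integral models of Theorems
4.1 ∕ 4.5 with their classifying maps on geometric points, and the ⟨CARRIER⟩ Hecke correspondences (4.15), (4.23).  Nothing is asserted.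
[cite: RapoportSmithlingZhang2020Diagonal, §4 p. 15, §4.1 pp. 15–18, §4.3 pp. 19–21] -/
structure Sec4Data (p : ℕ) [Fact p.Prime] : Type 2 extends Sec3Data F₀ F where
  /-- «`E`» is a number field (Remark 3.1 p. 9; the tree's ★ `finiteDimensional_traceField_sup_fieldRange` discharges it) — carried as a hypothesis so that
  `O_E`, its primes and localisations are available without declaring an instance. -/
  numberFieldE : NumberField (reflexFieldOf Φ φ₀)
  /-- «a `p`-adic place `ν` of `E`» (p. 15): a non-zero prime of `O_E` (REAL `E = reflexFieldOf Φ φ₀` of file 1) … -/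
  ν : HeightOneSpectrum (𝓞 (reflexFieldOf Φ φ₀))
  /-- … above `p`. -/
  ν_mem : (p : 𝓞 (reflexFieldOf Φ φ₀)) ∈ ν.asIdeal
  /-- «via `φ₀`, [the place] `w₀` of `F`» (p. 15): `w₀ = φ₀^{-1}(ν)` (`φ₀ : F → E`, file 1's REAL `phi0ToReflexFieldOf`, on rings of integers by Mathlib
  `RingOfIntegers.mapRingHom`). -/
  w₀ : HeightOneSpectrum (𝓞 F)
  /-- `w₀ = φ₀^{-1}(ν)` (p. 15). -/
  w₀_eq : w₀.asIdeal = ν.asIdeal.comap (RingOfIntegers.mapRingHom (phi0ToReflexFieldOf Φ φ₀))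
  /-- «[the place] `v₀` of `F₀`» below `w₀` (p. 15). -/
  v₀ : HeightOneSpectrum (𝓞 F₀)
  /-- `v₀ = w₀ ∩ O_{F₀}` (p. 15). -/
  v₀_eq : v₀.asIdeal = w₀.asIdeal.comap (algebraMap (𝓞 F₀) (𝓞 F))
  /-- ⟨CARRIER⟩ (4.7)–(4.8) (p. 16): «`w_φ` denotes the `p`-adic place in `F` induced by `ν̃ ∘ φ`» — the map `φ ↦ w_φ` on `Hom(F, ℂ) = Hom(F, ℚ̄)` (READING R9;
  the embedding `ν̃ : ℚ̄ → ℚ̄_p` itself is not constructed). -/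
  placeOf : (F →+* ℂ) → HeightOneSpectrum (𝓞 F)
  /-- every `w_φ` lies over `p` (p. 16). -/
  placeOf_mem : ∀ φ : F →+* ℂ, (p : 𝓞 F) ∈ (placeOf φ).asIdeal
  /-- `w_{φ₀} = w₀` (p. 15: «via `φ₀`, places `v₀` of `F₀` and `w₀` of `F`»). -/
  placeOf_φ₀ : placeOf φ₀ = w₀
  /-- **(4.8)** (p. 16): «`{φ ∈ Hom_ℚ(F, ℚ̄) ∣ w_φ = w} ≃ Hom_{ℚ_p}(F_w, ℚ̄_p)`» — as the REAL count `#{φ ∣ w_φ = w} = [F_w : ℚ_p] = e(w∣p)·f(w∣p)` (Mathlib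
  `Ideal.ramificationIdx`, `Ideal.inertiaDeg` over `ℤ`) for every place `w ∣ p` of `F`. -/
  card_placeOf : ∀ w : HeightOneSpectrum (𝓞 F), (p : 𝓞 F) ∈ w.asIdeal →
    Nat.card {φ : F →+* ℂ // placeOf φ = w} = w.asIdeal.ramificationIdx ℤ * w.asIdeal.inertiaDeg ℤ
  /-- «Throughout this section, we assume that the ideal `𝔞` occurring in the definition of `M₀^𝔞` is prime to `p`» (p. 15). -/
  𝔞_coprime : 𝔞 ⊔ Ideal.span {(p : 𝓞 F₀)} = ⊤
  /-- «det `W` ∈ F₀^×/Nm» (Notation (1.4) p. 6): the Gram determinant of `W` (★ `HermSpace.gram`, hermitian, so in `F₀`) as an element of `F₀` — REAL datum with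
  its defining equation `detW₀_eq` (used by «`W_{v₀}` is split», §4.1 p. 15). -/
  detW₀ : F₀
  /-- `detW₀ = det J_W` in `F` (p. 6). -/
  detW₀_eq : algebraMap F₀ F detW₀ = W.gram.det
  /-- ⟨CARRIER⟩ «For each `v ∈ 𝒱_p`, choose a vertex lattice `Λ_v` in the `F_v/F_{0,v}`-hermitian space `W_v`» (p. 15): the TYPE `t(v)` of `Λ_v`
  (`Λ_v ⊂^{t} Λ_v^∨ ⊂ π_v^{-1} Λ_v`, p. 7; `t = 0` = self-dual), for the places `v` of `F₀` above `p`. -/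
  vertexType : PlacesOverP F₀ p → ℕ
  /-- ⟨CARRIER⟩ `G(𝔸^p_{F₀,f})` as a subgroup of `G(𝔸_{F₀,f})` = ★ `HermSpace.Gfin` (elements with trivial `p`-component; READING R13). -/
  GAwayP : Subgroup W.Gfin
  /-- ⟨CARRIER⟩ `G(F₀ ⊗ ℚ_p) = ∏_{v ∈ 𝒱_p} G(F_{0,v})` as a subgroup of `G(𝔸_{F₀,f})` ((4.1) p. 15; elements with trivial prime-to-`p` component; READING R13). -/
  GAtP : Subgroup W.Gfin
  /-- ⟨CARRIER⟩ `G(F_{0,v₀})` as a subgroup of `G(𝔸_{F₀,f})` (elements trivial off `v₀`; (4.23) p. 21: «let `g ∈ G(F_{0,v₀})`, considered as an element in the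
  left-hand side» of `G̃(ℚ_p) = Z^ℚ(ℚ_p) × ∏_{v ∈ 𝒱_p} G(F_{0,v})`; READING R13). -/
  GAtV₀ : Subgroup W.Gfin
  /-- `G(F_{0,v₀}) ≤ G(F₀ ⊗ ℚ_p)` (the `v₀`-factor; REAL relation between the carriers). -/
  GAtV₀_le : GAtV₀ ≤ GAtP
  /-- ⟨CARRIER⟩ **(4.1)** «`K_{G,p} := ∏_{v ∈ 𝒱_p} K_{G,v}`, with `K_{G,v}` the stabilizer of `Λ_v` in `G(F_{0,v})`» (p. 15), read inside `G(𝔸_{F₀,f})` as the subgroup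
  `G(𝔸^p_{F₀,f}) × K_{G,p}` (READING R13). -/
  KGp : Subgroup W.Gfin
  /-- ⟨CARRIER⟩ **the Kottwitz condition (3.11)** for an abelian scheme `A` over an `O_{E,(ν)}`-scheme `f : S → Spec O_{E,(ν)}` with an `O_F ⊗ ℤ_{(p)}`-action `ι`, of
  signature `r` (p. 15: «`(A, ι)` … satisfying the Kottwitz condition (3.11) of signature `((1, n−1)_{φ₀}, (0, n)_{φ ∈ Φ∖{φ₀}})`»; READING R5 of file 1:
  «`char(ι(a) ∣ Lie A) = ∏_φ (T − φ(a))^{r_φ}`»).  BRIDGE WANTED (T-ref2 (c)): the tree's REAL ★ `Lan2013.PELTypeOLattice.KottwitzCondition` states the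
  determinant condition over a PEL-type `𝒪`-lattice datum and a base `S → Spec 𝒪_{F₀,(□)}`; presenting the RSZ datum `(O_F, Λ, ψ, h_{G̃})` as such a lattice datum
  over `O_E ⊇ O_{F₀}` is a construction this statement file does not make.  -- TODO(bridge): instantiate via ★ `KottwitzCondition`. -/
  IsKottwitzP : ∀ {S : Scheme.{0}}, (S ⟶ Spec (.of (OEνOf Φ φ₀ numberFieldE ν))) →
    ∀ A : AbelianSchemeOver S, A.RingAction (OFp F p) → ((F →+* ℂ) → ℕ) → Prop
  /-- ⟨CARRIER⟩ «`λ` is a polarization on `A` whose Rosati involution induces on `O_F ⊗ ℤ_{(p)}` the non-trivial Galois automorphism of `F/F₀`» (p. 15).  BRIDGE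
  WANTED (T-ref2 (c)): = the tree's REAL ★ `Lan2013.RosatiCondition D λ ι` («`λ ≫ i(b)^∨ = i(b⋆) ≫ λ`») once `O_F ⊗ ℤ_{(p)}` carries its conjugation as a
  `StarRing` structure (no such instance in the tree; statement files declare none).  -- TODO(bridge): `RosatiIsConjP := Lan2013.RosatiCondition`. -/
  RosatiIsConjP : ∀ {S : Scheme.{0}} (A : AbelianSchemeOver S) (Dp : A.DualPair), A.Polarization Dp → A.RingAction (OFp F p) → Prop
  /-- ⟨CARRIER⟩ **(4.2) and the kernel condition** (p. 15): «`A[p^∞] = ∏_{v ∈ 𝒱_p} A[v^∞]` … `λ` induces a polarization `λ_v : A[v^∞] → A^∨[v^∞]` … The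
  condition we impose is that `ker λ_v` is contained in `A[ι(π_v)]` of rank `#(Λ_v^∨/Λ_v)`» — at the place `v ∣ p` of `F₀` with vertex-lattice type `t`. -/
  KerCondP : ∀ {S : Scheme.{0}} (A : AbelianSchemeOver S) (Dp : A.DualPair), A.Polarization Dp → A.RingAction (OFp F p) →
    PlacesOverP F₀ p → ℕ → Prop
  /-- ⟨CARRIER⟩ **the sign condition (4.4)** at a place `v ∣ p`, `v ≠ v₀`, of `F₀` (p. 16): «only non-empty when `v` does not split in `F`, in which case it
  demands that at every point `s` of `S`, `inv^r_v(A₀,s, ι₀,s, λ₀,s, A_s, ι_s, λ_s) = inv_v(−W_v)`» (left: the sign factor (A.5)∕(A.8) of App. A; right: the Hasse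
  invariant (1.4) of `−W_v`) — on the REAL tuple `(A₀, ι₀, λ₀, A, ι, λ)` over `S`. -/
  SignCond : ∀ {S : Scheme.{0}} (A₀ : AbelianSchemeOver S) (_ι₀ : A₀.RingAction (𝓞 F)) (D₀ : A₀.DualPair) (_pol₀ : A₀.Polarization D₀)
    (A : AbelianSchemeOver S) (_ι : A.RingAction (OFp F p)) (Dp : A.DualPair) (_pol : A.Polarization Dp),
    PlacesOverP F₀ p → Prop
  /-- ⟨CARRIER⟩ **the Eisenstein condition (4.10)** at a place `v ∣ p`, `v ≠ v₀` (pp. 16–17): «only non-empty when the base scheme `S` has non-empty special fiber …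
  `Q_{A_ψ}(ι(π)) ∣ Lie_ψ A[w^∞] = 0` for each `w ∣ v` and each `ψ ∈ Hom_{ℚ_p}(F_w^t, ℚ̄_p)`», `Q_{A_ψ}(T) := ∏_{φ ∈ A_ψ} (T − φ(π))`,
  `A_ψ := {φ ∈ Hom_{ℚ_p}(F_w, ℚ̄_p) ∣ φ|_{F_w^t} = ψ and r_φ = n}` (p. 16), (4.9) `Lie A[w^∞] = ⊕_ψ Lie_ψ A[w^∞]`. -/
  EisensteinCond : ∀ {S : Scheme.{0}} (A : AbelianSchemeOver S), A.RingAction (OFp F p) →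
    PlacesOverP F₀ p → Prop
  /-- ⟨CARRIER⟩ **the further condition of §4.2 at `w̄₀`** (pp. 18–19; there `v₀` splits in `F` into `w₀` and `w̄₀` and may be ramified over `p`): «when `p` is
  locally nilpotent on `S`, the `p`-divisible group `A[w̄₀^∞]` is a Lubin–Tate group of type `r|_{w̄₀}`, in the sense of [RapoportZink2017, §8] (note that this
  involves the Eisenstein condition of loc. cit.)» — «if `v₀` is unramified over `p`, then this further Eisenstein condition is redundant» (p. 19). -/
  LubinTateCond : ∀ {S : Scheme.{0}} (A : AbelianSchemeOver S), A.RingAction (OFp F p) → Prop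
  /-- ⟨CARRIER⟩ the HEIGHT of the `w`-block `A[w^∞]` of the `p`-divisible group of `(A, ι)`, `w ∣ p` a place of `F` ((4.5) p. 16: «`A[p^∞] = ∏_{w ∣ p} A[w^∞]`»;
  junk off `w ∣ p`). -/
  pdivHeight : ∀ {S : Scheme.{0}} (A : AbelianSchemeOver S), A.RingAction (OFp F p) → HeightOneSpectrum (𝓞 F) → ℕ
  /-- ⟨CARRIER⟩ the DIMENSION of the `w`-block `A[w^∞]` (p. 16: «`Lie A = Lie A[p^∞] = ⊕_{w ∣ p} Lie A[w^∞]`», `p` locally nilpotent on `S`; junk otherwise). -/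
  pdivDim : ∀ {S : Scheme.{0}} (A : AbelianSchemeOver S), A.RingAction (OFp F p) → HeightOneSpectrum (𝓞 F) → ℕ
  /-- ⟨CARRIER⟩ **the objects of the §4.1 moduli problem** `M_{K_G̃}(G̃)(S)`, `K_G̃ = K_{Z^ℚ} × (K^p · K_{G,p})`, for a locally noetherian `O_{E,(ν)}`-scheme
  `f : S → Spec O_{E,(ν)}` and a level `K^p` away from `p` (pp. 15–17): «tuples `(A₀, ι₀, λ₀, A, ι, λ, η̄^p)`» with the clauses quoted in the module docstring —
  `(A₀, ι₀, λ₀) ∈ M₀^{𝔞,ξ}(S)`; `(A, ι)` with Kottwitz (3.11); `λ` with the Rosati and kernel conditions (4.2); **(4.3)** `η̄^p` a `K_G^p`-orbit of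
  `𝔸^p_{F,f}`-linear isometries `η^p : V̂^p(A₀, A) ≃ −W ⊗_F 𝔸^p_{F,f}`; the sign condition (4.4) and the Eisenstein condition (4.10) at each `v ≠ v₀` over `p`
  (and, in the regime of §4.2 — `v₀` split in `F` and ramified over `p` — the Lubin–Tate condition at `w̄₀`, pp. 18–19).  A TYPE (prime-to-`p` level structures
  on rational Tate modules have no tree vocabulary; meaningful for `S` locally noetherian, as printed); REAL projections below. -/
  Obj4 : Subgroup W.Gfin → ∀ {S : Scheme.{0}},
    (S ⟶ Spec (.of (OEνOf Φ φ₀ numberFieldE ν))) → Type 1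
  /-- ⟨CARRIER⟩ **the morphisms of the §4.1 moduli problem** (p. 17), as the relation «isomorphic»: «an isomorphism `(A₀, ι₀, λ₀) ≅ (A₀', ι₀', λ₀')` in
  `M₀^{𝔞,ξ}(S)` and a quasi-isogeny `A → A'` which induces an isomorphism `A[p^∞] ≅ A'[p^∞]`, compatible with `ι` and `ι'`, with `λ` and `λ'`, and with `η̄^p`
  and `η̄^{p'}`». -/
  Obj4Iso : ∀ {Kp : Subgroup W.Gfin} {S : Scheme.{0}}
    {f : S ⟶ Spec (.of (OEνOf Φ φ₀ numberFieldE ν))}, Obj4 Kp f → Obj4 Kp f → Prop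
  /-- REAL projection: the abelian scheme `A` (p. 15). -/
  intObjA : ∀ {Kp : Subgroup W.Gfin} {S : Scheme.{0}}
    {f : S ⟶ Spec (.of (OEνOf Φ φ₀ numberFieldE ν))}, Obj4 Kp f → AbelianSchemeOver S
  /-- REAL projection: the `O_F ⊗ ℤ_{(p)}`-action `ι` on `A` (p. 15; ★ `RingAction (OFp F p)`). -/
  intObjι : ∀ {Kp : Subgroup W.Gfin} {S : Scheme.{0}}
    {f : S ⟶ Spec (.of (OEνOf Φ φ₀ numberFieldE ν))} (x : Obj4 Kp f), (intObjA x).RingAction (OFp F p)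
  /-- REAL projection: the dual pair of `A` carrying `λ`. -/
  intObjD : ∀ {Kp : Subgroup W.Gfin} {S : Scheme.{0}}
    {f : S ⟶ Spec (.of (OEνOf Φ φ₀ numberFieldE ν))} (x : Obj4 Kp f), (intObjA x).DualPair
  /-- REAL projection: the polarization `λ` of `A` (p. 15). -/
  intObjPol : ∀ {Kp : Subgroup W.Gfin} {S : Scheme.{0}}
    {f : S ⟶ Spec (.of (OEνOf Φ φ₀ numberFieldE ν))} (x : Obj4 Kp f), (intObjA x).Polarization (intObjD x)
  /-- REAL projection: the component «`(A₀, ι₀, λ₀)` is an object of `M₀^{𝔞,ξ}(S)`» (p. 15) — an object of `M₀^𝔞` (file 1's ★ `M0Obj`, whose fields carry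
  the printed clauses (3.8), Rosati, `ker λ₀ = A₀[𝔞]`) over `S → Spec O_{E,(ν)} → Spec O_E`. -/
  intObjM0 : ∀ {Kp : Subgroup W.Gfin} {S : Scheme.{0}} {f : S ⟶ Spec (.of (OEνOf Φ φ₀ numberFieldE ν))},
    Obj4 Kp f → M0Obj F₀ F toSec3Data.clauses 𝔞 (f ≫ specOEνToSpecOEOf Φ φ₀ numberFieldE ν)
  /-- AXIOM of the carrier (p. 15: the component lies in the summand `M₀^{𝔞,ξ}`): over a connected base its label (file 1's `label`) is `ξ`. -/
  intObjM0_label : ∀ {Kp : Subgroup W.Gfin} {S : Scheme.{0}} [ConnectedSpace S] {f : S ⟶ Spec (.of (OEνOf Φ φ₀ numberFieldE ν))} (x : Obj4 Kp f),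
    toSec3Data.label 𝔞 𝔞_ne_bot (f ≫ specOEνToSpecOEOf Φ φ₀ numberFieldE ν) (intObjM0 x) = ξ
  /-- AXIOM of the carrier: the REAL projections `(A, ι, λ)` of every object satisfy the printed clauses of pp. 15–17 — the Kottwitz condition (3.11) at the
  REAL signature (3.14) (`IsKottwitzP`), the Rosati condition (`RosatiIsConjP`), the kernel condition (4.2) at every `v ∈ 𝒱_p` with the type of `Λ_v`
  (`KerCondP`), for every `v ≠ v₀` in `𝒱_p` the sign condition (4.4) (`SignCond`) and the Eisenstein condition (4.10) (`EisensteinCond`), and — in the regime of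
  §4.2, `v₀` ramified over `p` (pp. 18–19) — the Lubin–Tate condition at `w̄₀` (`LubinTateCond`; redundant for `v₀` unramified, p. 19). -/
  intObj_clauses : ∀ {Kp : Subgroup W.Gfin} {S : Scheme.{0}} {f : S ⟶ Spec (.of (OEνOf Φ φ₀ numberFieldE ν))} (x : Obj4 Kp f),
    IsKottwitzP f (intObjA x) (intObjι x) toSec3Data.toShimuraDatum.signatureFn ∧
    RosatiIsConjP (intObjA x) (intObjD x) (intObjPol x) (intObjι x) ∧
    (∀ v : PlacesOverP F₀ p, KerCondP (intObjA x) (intObjD x) (intObjPol x) (intObjι x) v (vertexType v)) ∧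
    (∀ v : PlacesOverP F₀ p, v.1 ≠ v₀ →
      SignCond (intObjM0 x).A₀ (intObjM0 x).ι₀ (intObjM0 x).D₀ (intObjM0 x).pol₀ (intObjA x) (intObjι x) (intObjD x) (intObjPol x) v ∧
      EisensteinCond (intObjA x) (intObjι x) v) ∧
    (v₀.asIdeal.ramificationIdx ℤ ≠ 1 → LubinTateCond (intObjA x) (intObjι x))
  /-- ⟨CARRIER⟩ **the integral model `M_{K_G̃}(G̃)` over `Spec O_{E,(ν)}`** for the level `K^p` — the DM stack of Theorem 4.1 (§4.1, p. 17) and of Theorem 4.2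
  (§4.2, p. 19: `v₀` split in `F`, possibly ramified over `p`; «the same as the one defined in the previous subsection» when `v₀` is unramified), READ THROUGH A
  SCHEME over the REAL `O_{E,(ν)}` (the reading of the HC_CM lines, `n = 2`, neat level; meaningful for `K^p` small enough). -/
  intModel : Subgroup W.Gfin → SchemeOver (OEνOf Φ φ₀ numberFieldE ν)
  /-- ⟨CARRIER⟩ the classifying map of `intModel Kp` on geometric points: an object over an algebraically closed field `Ω ⊇ O_{E,(ν)}` ↦ its `Ω`-point. -/
  intPt : ∀ (Kp : Subgroup W.Gfin) (Ω : Type) [Field Ω] [Algebra (OEνOf Φ φ₀ numberFieldE ν) Ω],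
    IsAlgClosed Ω → Obj4 Kp (Spec.map (CommRingCat.ofHom (algebraMap (OEνOf Φ φ₀ numberFieldE ν) Ω))) →
      PointsOver (intModel Kp) Ω
  /-- ⟨CARRIER⟩ **(4.15)** (p. 18): for `g ∈ G̃(𝔸^p_f)` and `K'^p = K^p ∩ gK^pg^{-1}`, the morphism `nat₁ : M_{K'_G̃}(G̃) → M_{K_G̃}(G̃)` (over `O_{E,(ν)}`). -/
  natOne : ∀ (Kp : Subgroup W.Gfin) (g : W.Gfin), intModel (Kp ⊓ MulAut.conj g • Kp) ⟶ intModel Kp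
  /-- ⟨CARRIER⟩ **(4.15)** (p. 18): the morphism `nat_g : M_{K'_G̃}(G̃) → M_{K_G̃}(G̃)` («`η̄^p ↦ η̄^p g`»). -/
  natG : ∀ (Kp : Subgroup W.Gfin) (g : W.Gfin), intModel (Kp ⊓ MulAut.conj g • Kp) ⟶ intModel Kp
  /-- ⟨CARRIER⟩ §4.3 (p. 19) «We define the level subgroup `K^m_G ⊂ G(𝔸_{F₀,f})` in exactly the same way as `K_G` in Section 4.1 …, except in the `v₀`-factor
  where `G(F_{0,v₀}) ≃ GL_n(F_{0,v₀})`, we take `K^m_{G,v₀}` to be the principal congruence subgroup modulo `p^m_{v₀}` inside `K_{G,v₀}`», read (READING R13) as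
  the subgroup `G(𝔸^p_{F₀,f}) × K^m_{G,p}` of `G(𝔸_{F₀,f})`. -/
  Km : ℕ → Subgroup W.Gfin
  /-- «In particular, `K_G` coincides with `K^m_G` for `m = 0`» (p. 19). REAL equation. -/
  Km_zero : Km 0 = KGp
  /-- ⟨CARRIER⟩ **the objects of `M_{K^m_G̃}(G̃)(S)`** (§4.3 p. 20): an object of the §4.1 problem «equipped with the following additional datum … an
  `O_{F,w₀}`-linear homomorphism of finite flat group schemes `φ : π_{w₀}^{-m} Λ_{w₀}/Λ_{w₀} → Hom_{O_{F,w₀}}(A₀[w₀^m], A[w₀^m])` (4.21), which is a Drinfeld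
  `w₀^m`-structure on the target, cf. [HarrisTaylorAMS2001, §II.2]» (`T_{w₀}(A₀, A)[w₀^m] := Hom_{O_{F,w₀}}(A₀[w₀^m], A[w₀^m])`, p. 20).  A TYPE. -/
  ObjDr : ℕ → Subgroup W.Gfin → ∀ {S : Scheme.{0}},
    (S ⟶ Spec (.of (OEνOf Φ φ₀ numberFieldE ν))) → Type 1
  /-- REAL projection: the underlying object of the §4.1 problem (p. 20: «we equip the object `(A₀, ι₀, λ₀, A, ι, λ, η̄^p) ∈ M_{K_G̃}(G̃)` with the following
  additional datum»). -/
  drObj : ∀ {m : ℕ} {Kp : Subgroup W.Gfin} {S : Scheme.{0}}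
    {f : S ⟶ Spec (.of (OEνOf Φ φ₀ numberFieldE ν))}, ObjDr m Kp f → Obj4 Kp f
  /-- ⟨CARRIER⟩ isomorphism of objects of `M_{K^m_G̃}(G̃)(S)` (an isomorphism of the underlying §4.1 objects carrying `φ` to `φ'`). -/
  ObjDrIso : ∀ {m : ℕ} {Kp : Subgroup W.Gfin} {S : Scheme.{0}}
    {f : S ⟶ Spec (.of (OEνOf Φ φ₀ numberFieldE ν))}, ObjDr m Kp f → ObjDr m Kp f → Prop
  /-- ⟨CARRIER⟩ **the integral model of Theorem 4.5** `M_{K^m_G̃}(G̃)` (p. 20), read through a scheme over `O_{E,(ν)}` as for `intModel`. -/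
  drModel : ℕ → Subgroup W.Gfin → SchemeOver (OEνOf Φ φ₀ numberFieldE ν)
  /-- ⟨CARRIER⟩ the forgetful morphism `M_{K^m_G̃}(G̃) → M_{K_G̃}(G̃)` of Theorem 4.5 (over `O_{E,(ν)}`). -/
  drToInt : ∀ (m : ℕ) (Kp : Subgroup W.Gfin), drModel m Kp ⟶ intModel Kp
  /-- ⟨CARRIER⟩ the classifying map of `drModel m Kp` on geometric points. -/
  drPt : ∀ (m : ℕ) (Kp : Subgroup W.Gfin) (Ω : Type) [Field Ω] [Algebra (OEνOf Φ φ₀ numberFieldE ν) Ω],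
    IsAlgClosed Ω → ObjDr m Kp (Spec.map (CommRingCat.ofHom (algebraMap (OEνOf Φ φ₀ numberFieldE ν) Ω))) →
      PointsOver (drModel m Kp) Ω
  /-- ⟨CARRIER⟩ **(4.23)** (p. 21): for `g ∈ G(F_{0,v₀})` and `μ` large, `nat₁ : M_{K^{2eμ}_G̃}(G̃) → M_{K^m_G̃}(G̃)` («restriction of `φ` to `π^{-m}Λ_{w₀}/Λ_{w₀}`»),
  `e = e(v₀ ∣ p)` the REAL ramification index. -/
  drNatOne : ∀ (m μ : ℕ) (Kp : Subgroup W.Gfin) (g : W.Gfin), drModel (2 * v₀.asIdeal.ramificationIdx ℤ * μ) Kp ⟶ drModel m Kp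
  /-- ⟨CARRIER⟩ **(4.23)** (p. 21): `nat_g : M_{K^{2eμ}_G̃}(G̃) → M_{K^m_G̃}(G̃)` (moduli description pp. 21–22: `A' = A/C`, …). -/
  drNatG : ∀ (m μ : ℕ) (Kp : Subgroup W.Gfin) (g : W.Gfin), drModel (2 * v₀.asIdeal.ramificationIdx ℤ * μ) Kp ⟶ drModel m Kp
  /-- ⟨CARRIER⟩ «`μ` large enough that `p^μ_{v₀} Λ_{v₀} ⊂ g Λ_{v₀} ⊂ ϖ^{−m}_{v₀} g Λ_{v₀} ⊂ p^{−μ}_{v₀} Λ_{v₀}`» (p. 21) — the admissibility of `μ` for `(m, g)`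
  (the lattices `Λ_{v₀}`, `gΛ_{v₀}` are not constructed). -/
  MuLarge : ℕ → ℕ → W.Gfin → Prop

namespace Sec4Data

variable {F₀ F} {p : ℕ} [Fact p.Prime]

section Plumbing

variable (D : Sec4Data F₀ F p)

/-- `O_{E,(ν)}` (p. 15), the localisation of `O_E` at `ν`, as Mathlib's valuation subring of `E` (READING R10).
[cite: RapoportSmithlingZhang2020Diagonal, §4 p. 15] -/
abbrev OEν : ValuationSubring D.E := OEνOf D.Φ D.φ₀ D.numberFieldE D.ν

/-- The structure map `Spec O_{E,(ν)} → Spec O_E` for the datum. [cite: RapoportSmithlingZhang2020Diagonal, §4.1 p. 15] -/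
abbrev specOEνToSpecOE : Spec (.of D.OEν) ⟶ Spec (.of (𝓞 D.E)) := specOEνToSpecOEOf D.Φ D.φ₀ D.numberFieldE D.ν

/-- **(4.1)** (p. 15): `K_G = K_G^p × K_{G,p}` inside `G(𝔸_{F₀,f})` — with READING R13, the intersection of `Kp` (`= K_G^p × G(F₀ ⊗ ℚ_p)`) and `KGp`
(`= G(𝔸^p_{F₀,f}) × K_{G,p}`). [cite: RapoportSmithlingZhang2020Diagonal, §4.1 (4.1) p. 15] -/
def KG (Kp : Subgroup D.W.Gfin) : Subgroup D.W.Gfin := Kp ⊓ D.KGp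

/-- «`K^m_G̃ := K_{Z^ℚ} × K^m_G`» with «`K^m_G`» = `K^p · K^m_{G,p}` (§4.3 p. 19), inside `G(𝔸_{F₀,f})` (READING R13).
[cite: RapoportSmithlingZhang2020Diagonal, §4.3 p. 19] -/
def KmG (m : ℕ) (Kp : Subgroup D.W.Gfin) : Subgroup D.W.Gfin := Kp ⊓ D.Km m

/-- A level away from `p`: `K^p` open compact and of the form `K_G^p × G(F₀ ⊗ ℚ_p)`, i.e. containing the ⟨CARRIER⟩ factor `G(F₀ ⊗ ℚ_p)` (READING R13; p. 15 «`K^p_G ⊂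
G(𝔸^p_{F₀,f})` is arbitrary»). [cite: RapoportSmithlingZhang2020Diagonal, §4.1 (4.1) p. 15] -/
def IsLevelAwayP (Kp : Subgroup D.W.Gfin) : Prop :=
  D.IsLevel (D.KG Kp) ∧ D.GAtP ≤ Kp

/-- The generic fibre `X ×_{Spec O_{E,(ν)}} Spec E` of an `O_{E,(ν)}`-scheme, as an `E`-scheme (★ `Motives.baseChange`; REAL).
[cite: RapoportSmithlingZhang2020Diagonal, §4.1 Theorem 4.1 p. 17] -/
abbrev genericFibre (X : SchemeOver D.OEν) : SchemeOver D.E :=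
  (Literature.AlgebraicGeometry.Motives.baseChange D.OEν D.E).obj X

end Plumbing

/-! ## The standing hypotheses of §4.1 (p. 15) and of §§4.2–4.3 (pp. 18–19), and the matching condition (4.19) — PREDICATES on the datum (hypotheses of
the rows below, not results) -/

/-- **The standing hypotheses of §4.1** (p. 15): «we assume that the place `v₀` is unramified over `p`, and that `v₀` either splits in `F` or is inert in `F` and
the hermitian space `W_{v₀}` is split. We also assume `p ≠ 2` if there is any `v ∈ 𝒱_p` which is non-split in `F`» (footnote 8: relaxed in [41, §§4–5]), and «we
may and do take `Λ_{v₀}` to be self-dual».  REAL: `e(v₀∣p) = 1`; SPLIT = two places of `F` over `v₀`; INERT = `w₀` is the only place over `v₀`, with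
`e(w₀∣v₀) = 1`, `f(w₀∣v₀) = 2`; «`W_{v₀}` split» = `inv_{v₀}(W_{v₀}) = 1` ((1.4) p. 6: `inv_v(W_v) := (−1)^{n(n−1)/2} det W_v ∈ F^×_{0,v}/Nm F_v^×`), which for `v₀`
inert and unramified reads «the `v₀`-adic order of `(−1)^{n(n−1)/2} det W` is even» (READING R12); `vertexType v₀ = 0`.
[cite: RapoportSmithlingZhang2020Diagonal, §4.1 p. 15; Notation (1.4) p. 6] -/
def HyperspecialHypotheses (D : Sec4Data F₀ F p) : Prop :=
  D.v₀.asIdeal.ramificationIdx ℤ = 1 ∧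
  ((Nat.card {w : HeightOneSpectrum (𝓞 F) // w.asIdeal.comap (algebraMap (𝓞 F₀) (𝓞 F)) = D.v₀.asIdeal} = 2) ∨
    ((∀ w : HeightOneSpectrum (𝓞 F), w.asIdeal.comap (algebraMap (𝓞 F₀) (𝓞 F)) = D.v₀.asIdeal → w = D.w₀) ∧
      D.w₀.asIdeal.ramificationIdx (𝓞 F₀) = 1 ∧ D.w₀.asIdeal.inertiaDeg (𝓞 F₀) = 2 ∧
      Even (WithZero.log ((D.v₀.valuation F₀) ((-1 : F₀) ^ (D.n * (D.n - 1) / 2) * D.detW₀))))) ∧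
  ((∃ v : PlacesOverP F₀ p, ∀ w w' : HeightOneSpectrum (𝓞 F),
      w.asIdeal.comap (algebraMap (𝓞 F₀) (𝓞 F)) = v.1.asIdeal → w'.asIdeal.comap (algebraMap (𝓞 F₀) (𝓞 F)) = v.1.asIdeal → w = w') → p ≠ 2) ∧
  (∀ h : (p : 𝓞 F₀) ∈ D.v₀.asIdeal, D.vertexType ⟨D.v₀, h⟩ = 0)

/-- **The standing hypotheses of §4.2 and §4.3** (p. 18: «We continue with the setup and assumptions of the previous subsection, except we now allow `v₀` to be
ramified over `p`. In addition, we assume that `v₀` splits in `F`»; p. 19: «We continue with the setup and assumptions of Section 4.2, with `v₀` split in `F` and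
possibly ramified over `p`»).  REAL: two places of `F` over `v₀`; the `p ≠ 2` clause of §4.1; `Λ_{v₀}` self-dual (`vertexType v₀ = 0`; `K_{G,v₀}` its stabilizer,
inside which §4.3 takes `K^m_{G,v₀}`, p. 19). [cite: RapoportSmithlingZhang2020Diagonal, §4.2 p. 18; §4.3 p. 19] -/
def SplitDrinfeldHypotheses (D : Sec4Data F₀ F p) : Prop :=
  Nat.card {w : HeightOneSpectrum (𝓞 F) // w.asIdeal.comap (algebraMap (𝓞 F₀) (𝓞 F)) = D.v₀.asIdeal} = 2 ∧
  ((∃ v : PlacesOverP F₀ p, ∀ w w' : HeightOneSpectrum (𝓞 F),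
      w.asIdeal.comap (algebraMap (𝓞 F₀) (𝓞 F)) = v.1.asIdeal → w'.asIdeal.comap (algebraMap (𝓞 F₀) (𝓞 F)) = v.1.asIdeal → w = w') → p ≠ 2) ∧
  (∀ h : (p : 𝓞 F₀) ∈ D.v₀.asIdeal, D.vertexType ⟨D.v₀, h⟩ = 0)

/-- **[RSZ2020, (4.19)] the matching condition** (p. 19): «we require that the matching condition between the CM type `Φ` and the chosen place `ν` of `E` is
satisfied, which demands that `{φ ∈ Hom(F, ℚ̄) ∣ w_φ = w₀} ⊂ Φ` (4.19), where `w_φ` is the place of `F` induced by `ν̃ ∘ φ`, as in (4.8) … When condition (4.19)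
is satisfied, we also say that the CM type `Φ` and the place `ν` of `E` are matched» — every embedding inducing the place `w₀` lies in the CM type `Φ` (so that,
with the Kottwitz condition, `A[w₀^∞]` is a one-dimensional formal `O_{F,w₀}`-module, p. 20); a CONDITION on the datum (REAL over the place map of READING R9),
the hypothesis of Theorem 4.5 and the conclusion of Lemma 4.3 (in whose case (ii) «the left-hand side of (4.19) is the singleton set `{φ₀}`»).
[cite: RapoportSmithlingZhang2020Diagonal, §4.3 (4.19) p. 19] -/
def MatchingCondition (D : Sec4Data F₀ F p) : Prop :=
  ∀ φ : F →+* ℂ, D.placeOf φ = D.w₀ → φ ∈ D.Φ.1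

section Rows

variable (D : Sec4Data F₀ F p)

/-! ## §4.1: (4.5)–(4.6) (p. 16) -/

/-- **[RSZ2020, (4.5)–(4.6)]** (p. 16): «`A[p^∞] = ∏_{w ∣ p} A[w^∞]` … Since we assume that `p` is locally nilpotent on `S` … For each place `w`, by the Kottwitz
condition (3.11), the `p`-divisible group `A[w^∞]` is of height `n · [F_w : ℚ_p]` and dimension `dim A[w^∞] = Σ_{φ ∈ Hom(F_w, ℚ̄_p)} r_φ` (4.6).  Here `r_φ` is as
in (3.14)» — for every object over a locally noetherian `O_{E,(ν)}`-scheme `S` on which `p` is locally nilpotent (nilpotent in every stalk `O_{S,s}`), with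
`[F_w : ℚ_p] = e(w∣p) f(w∣p)` and `Hom(F_w, ℚ̄_p) = {φ ∣ w_φ = w}` (4.8) (READING R9), on the ⟨CARRIER⟩ invariants `pdivHeight`, `pdivDim`.
[cite: RapoportSmithlingZhang2020Diagonal, §4.1 (4.5)–(4.6) p. 16] -/
def eq46_heightDim : Prop :=
  ∀ (Kp : Subgroup D.W.Gfin) {S : Scheme.{0}} [IsLocallyNoetherian S] (f : S ⟶ Spec (.of D.OEν)) (x : D.Obj4 Kp f),
    (∀ s : S, IsNilpotent (p : S.presheaf.stalk s)) →
    ∀ w : HeightOneSpectrum (𝓞 F), (p : 𝓞 F) ∈ w.asIdeal →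
      D.pdivHeight (D.intObjA x) (D.intObjι x) w = D.n * (w.asIdeal.ramificationIdx ℤ * w.asIdeal.inertiaDeg ℤ) ∧
      D.pdivDim (D.intObjA x) (D.intObjι x) w = ∑ φ ∈ Finset.univ.filter (fun φ : F →+* ℂ => D.placeOf φ = w), D.signatureFn φ

/-! ## Theorem 4.1 (p. 17) and the prime-to-`p` Hecke correspondences (4.15)–(4.16) (p. 18) -/

/-- **[RSZ2020, Theorem 4.1]** (p. 17): «The moduli problem just formulated is representable by a Deligne–Mumford stack `M_{K_G̃}(G̃)` smooth over
`Spec O_{E,(ν)}`. For `K_G^p` small enough, `M_{K_G̃}(G̃)` is relatively representable over `M₀^{𝔞,ξ}`. Furthermore, the generic fiber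
`M_{K_G̃}(G̃) ×_{Spec O_{E,(ν)}} Spec E` is canonically isomorphic to `M_{K_G̃}(G̃)`.» (under the standing hypotheses of §4.1, `HyperspecialHypotheses`).  TYPED,
through the ⟨CARRIER⟩ scheme `intModel` (the reading of the HC_CM lines): there is a level `K₀^p` such that for every level `K^p ≤ K₀^p` away from `p` — (a) `intPt`
is a bijection from isomorphism classes of objects over every algebraically closed field `Ω ⊇ O_{E,(ν)}` onto `(intModel K^p)(Ω)`; (b) `intModel K^p → Spec O_{E,(ν)}`
is smooth (Mathlib `Smooth`); (c) its generic fibre is `E`-isomorphic to the coarse space `coarse (K_G)` of `M_{K_G̃}(G̃)` (Proposition 3.7, file 1).  RECORDED, not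
typed: the DM-stack wording and relative representability over `M₀^{𝔞,ξ}`.  -- TODO(general form): DM stacks; all levels `K^p`.
[cite: RapoportSmithlingZhang2020Diagonal, §4.1 Theorem 4.1 p. 17] -/
def Thm41 : Prop :=
  D.HyperspecialHypotheses →
    ∃ K₀ : Subgroup D.W.Gfin, D.IsLevelAwayP K₀ ∧ ∀ Kp : Subgroup D.W.Gfin, D.IsLevelAwayP Kp → Kp ≤ K₀ →
      (∀ (Ω : Type) [Field Ω] [Algebra D.OEν Ω] (hΩ : IsAlgClosed Ω),
          Function.Surjective (D.intPt Kp Ω hΩ) ∧ ∀ x y, D.intPt Kp Ω hΩ x = D.intPt Kp Ω hΩ y ↔ D.Obj4Iso x y) ∧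
      Smooth (D.intModel Kp).hom ∧
      Nonempty (D.genericFibre (D.intModel Kp) ≅ D.coarse (D.KG Kp))

/-- **[RSZ2020, (4.15)]** (p. 18): «Fix `g ∈ G̃(𝔸^p_f)`. Let … `K'^p_G̃ := K^p_G̃ ∩ gK^p_G̃g^{-1}` and `K'_G̃ := K'^p_G̃ × K_{G̃,p}`. Then we obtain in the standard way a
diagram of finite étale morphisms `nat₁, nat_g : M_{K'_G̃}(G̃) → M_{K_G̃}(G̃)` (4.15), which we view as a correspondence from `M_{K_G̃}(G̃)` to itself» (§4.1; and
§4.2 p. 19: «Hecke correspondences exactly as in the previous subsection») — under the standing hypotheses of §4.1 or of §4.2, for `g ∈ G(𝔸^p_{F₀,f})` (⟨CARRIER⟩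
`GAwayP`; the `Z^ℚ`-component is fixed by READING R3 — the special case used by the HC_CM lines) and `K^p` a level away from `p`: the ⟨CARRIER⟩ maps `natOne`,
`natG` (morphisms OVER `O_{E,(ν)}` by their type) are finite (Mathlib `IsFinite`) and étale (Mathlib `Etale`).  -- TODO(general form): `g ∈ G̃(𝔸^p_f)`.
[cite: RapoportSmithlingZhang2020Diagonal, §4.1 (4.15) p. 18; §4.2 p. 19] -/
def hecke415 : Prop :=
  D.HyperspecialHypotheses ∨ D.SplitDrinfeldHypotheses →
    ∀ (Kp : Subgroup D.W.Gfin) (g : D.W.Gfin), D.IsLevelAwayP Kp → g ∈ D.GAwayP →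
      IsFinite (D.natOne Kp g).left ∧ Etale (D.natOne Kp g).left ∧ IsFinite (D.natG Kp g).left ∧ Etale (D.natG Kp g).left

/-- **[RSZ2020, (4.16)]** (p. 18): «for a central element `g = z ∈ Z(G)(𝔸^p_{F₀,f}) = {z ∈ (𝔸^p_{F,f})^× ∣ Nm_{F/F₀}(z) = 1}`, the diagram (4.15) collapses to a map
`M_{K_G̃}(G̃) →z M_{K_G̃}(G̃)` (4.16) and this induces an action of `Z(G)(𝔸^p_{F₀,f})` on `M_{K_G̃}(G̃)`» — under the standing hypotheses of §4.1 or of §4.2, for `z`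
central in `G(𝔸_{F₀,f})` and prime to `p`: `zK^pz^{-1} = K^p`, so `K'^p = K^p`, and `nat₁` is an isomorphism (the map (4.16) being `nat_z ∘ nat₁^{-1}`).
[cite: RapoportSmithlingZhang2020Diagonal, §4.1 (4.16) p. 18; §4.2 p. 19] -/
def hecke416 : Prop :=
  D.HyperspecialHypotheses ∨ D.SplitDrinfeldHypotheses →
    ∀ (Kp : Subgroup D.W.Gfin) (z : D.W.Gfin), D.IsLevelAwayP Kp → z ∈ D.GAwayP → z ∈ Subgroup.center D.W.Gfin →
      Kp ⊓ MulAut.conj z • Kp = Kp ∧ IsIso (D.natOne Kp z)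

/-! ## §4.3: Lemma 4.3, Theorem 4.5, the Hecke correspondences (4.23) (pp. 19–21) -/

/-- **[RSZ2020, Lemma 4.3]** (p. 19): «The matching condition for `Φ` and `ν` is satisfied in each of the following two situations. (i) `F` is of the form `K F₀` for
an imaginary quadratic field `K/ℚ`, `Φ` is the unique CM type induced from `K` containing `φ₀`, and `p` splits in `K`. (ii) The place `v₀` is of degree `1` over
`ℚ`.» ((i): `K ⊆ F`, `[K : ℚ] = 2`, `K · F₀ = F`, `Φ = {φ ∣ φ|_K = φ₀|_K}`, and two distinct primes of `O_K` above `p`; (ii): `e(v₀∣p) f(v₀∣p) = 1`.)  (Remark 4.4: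
«We call the case (i) the Harris–Taylor case».) [cite: RapoportSmithlingZhang2020Diagonal, §4.3 Lemma 4.3 p. 19] -/
def Lemma43 : Prop :=
  ((∃ K : IntermediateField ℚ F, Module.finrank ℚ K = 2 ∧ K ⊔ (IsScalarTower.toAlgHom ℚ F₀ F).fieldRange = ⊤ ∧
      (∀ φ : F →+* ℂ, φ ∈ D.Φ.1 ↔ ∀ x : K, φ (x : F) = D.φ₀ (x : F)) ∧
      ∃ P Q : HeightOneSpectrum (𝓞 K), P ≠ Q ∧ (p : 𝓞 K) ∈ P.asIdeal ∧ (p : 𝓞 K) ∈ Q.asIdeal) → D.MatchingCondition) ∧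
  (D.v₀.asIdeal.ramificationIdx ℤ * D.v₀.asIdeal.inertiaDeg ℤ = 1 → D.MatchingCondition)

/-- **[RSZ2020, Theorem 4.5]** (p. 20; standing hypotheses of §4.3 — `v₀` split in `F`, possibly ramified over `p` — and the matching condition (4.19)): «The moduli
problem `M_{K^m_G̃}(G̃)` is relatively representable by a finite flat morphism to `M_{K_G̃}(G̃)`. It is regular and flat over `Spec O_{E,(ν)}`. Furthermore, the generic
fiber `M_{K^m_G̃}(G̃) ×_{Spec O_{E,(ν)}} Spec E` is canonically isomorphic to `M_{K^m_G̃}(G̃)`» — through the ⟨CARRIER⟩ schemes `drModel m K^p → intModel K^p` (the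
reading of the HC_CM lines), for `K^p` a level away from `p`: (a) `drToInt` lies over `O_{E,(ν)}` and is finite and flat (Mathlib `IsFinite`, `Flat`), and
`drPt`∕`intPt` are compatible with `drObj` and classify `ObjDr` on geometric points; (b) `drModel m K^p → Spec O_{E,(ν)}` is flat; (c) the generic fibre is
`E`-isomorphic to the coarse space `coarse (K^p ⊓ K^m)` of `M_{K^m_G̃}(G̃)` (Proposition 3.7); (d) «regular»: every local ring of `drModel m K^p` is a regular
local ring (Mathlib `IsRegularLocalRing` on the stalks).  RECORDED, not typed: the stack wording.  -- TODO(general form): DM stacks.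
[cite: RapoportSmithlingZhang2020Diagonal, §4.3 Theorem 4.5 p. 20] -/
def Thm45 : Prop :=
  D.SplitDrinfeldHypotheses → D.MatchingCondition →
    ∀ (m : ℕ) (Kp : Subgroup D.W.Gfin), D.IsLevelAwayP Kp →
      IsFinite (D.drToInt m Kp).left ∧ Flat (D.drToInt m Kp).left ∧ Flat (D.drModel m Kp).hom ∧
      (∀ (Ω : Type) [Field Ω] [Algebra D.OEν Ω] (hΩ : IsAlgClosed Ω),
          Function.Surjective (D.drPt m Kp Ω hΩ) ∧ (∀ x y, D.drPt m Kp Ω hΩ x = D.drPt m Kp Ω hΩ y ↔ D.ObjDrIso x y) ∧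
          ∀ x, D.drPt m Kp Ω hΩ x ≫ D.drToInt m Kp = D.intPt Kp Ω hΩ (D.drObj x)) ∧
      Nonempty (D.genericFibre (D.drModel m Kp) ≅ D.coarse (D.KmG m Kp)) ∧
      (∀ x : ↥(D.drModel m Kp).left, IsRegularLocalRing ((D.drModel m Kp).left.presheaf.stalk x))

/-- **[RSZ2020, (4.23)] Hecke correspondences at Drinfeld level** (p. 21; standing hypotheses of §4.3 and the matching condition): «let `g ∈ G(F_{0,v₀})` … For
general `g ∈ G(F_{0,v₀})`, choose `μ` large enough that `p^μ_{v₀} Λ_{v₀} ⊂ g Λ_{v₀} ⊂ ϖ^{−m}_{v₀} g Λ_{v₀} ⊂ p^{−μ}_{v₀} Λ_{v₀}`. Then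
`K^{2eμ}_{G̃,v₀} ⊂ K^m_{G,v₀} ∩ gK^m_{G,v₀}g^{-1}`, where `e = e_{v₀}` is the ramification index of `v₀` over `p`. Hence we obtain a diagram of finite flat morphisms
`nat₁, nat_g : M_{K^{2eμ}_G̃}(G̃) → M_{K^m_G̃}(G̃)` (4.23) as before.» — the ⟨CARRIER⟩ maps `drNatOne`, `drNatG` (over `O_{E,(ν)}` by their type) for `g ∈ G(F_{0,v₀})`
(⟨CARRIER⟩ `GAtV₀`) and `μ` admissible (⟨CARRIER⟩ `MuLarge`) are finite and flat; the REAL group-theoretic clause `K^{2eμ} ≤ K^m ∩ gK^mg^{-1}` is typed on the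
⟨CARRIER⟩ subgroups `Km`.  The moduli description of `nat_g` (pp. 21–22) is recorded in the module docstring.
[cite: RapoportSmithlingZhang2020Diagonal, §4.3 (4.23) p. 21] -/
def hecke423 : Prop :=
  D.SplitDrinfeldHypotheses → D.MatchingCondition →
    ∀ (m μ : ℕ) (Kp : Subgroup D.W.Gfin) (g : D.W.Gfin), D.IsLevelAwayP Kp → g ∈ D.GAtV₀ → D.MuLarge m μ g →
      D.Km (2 * D.v₀.asIdeal.ramificationIdx ℤ * μ) ≤ D.Km m ⊓ MulAut.conj g • D.Km m ∧
      IsFinite (D.drNatOne m μ Kp g).left ∧ Flat (D.drNatOne m μ Kp g).left ∧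
      IsFinite (D.drNatG m μ Kp g).left ∧ Flat (D.drNatG m μ Kp g).left

end Rows

end Sec4Data

end Literature.AlgebraicGeometry.ShimuraVarieties.RapoportSmithlingZhang2020.Sec4CitedRows

end
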